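import Summits.BirchSwinnertonDyer.BirchSwinnertonDyer.Theorems.SchneiderFreeAdditiveX3LogOmegaConjugatePrime
import HarnessLib
import HarnessLib.Audit.Tags

/-!
# Route `SchneiderFreeAdditiveX3` (K1 door), crux `GordTwoBranchIMC` (stmt-BirchSwinnertonDyer-19177):
# an embedding of a quadratic `K` into a `p`-adic field that INDUCES the degree-one prime `𝔭′`
# IS `embAt K p 𝔭′` — the glue between a `ι′`-side value formula and the `embAt`-side `KYReadCHValue`

Cell `bsd-schneider-ideate` (HOME `run/shared/lean/pub/bsd-schneider-ideate/`), seat `door-c3` gen 10.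
PARTITION: board row B6 ∩ X3 ∩ sst-twist, r = 1, (G-ord, `e = 2`) half (2 560 of 7 101 pairs) of
`Rank1Residual.partition`; plumbing for crux r3's last untyped input (the value half of `stub_CH`):
the hypothesis `hj : j|_K = e ∘ ι_p` of the descent theorem `padicLog_map_eq_mul_logOmega_of_descent`
(`…KYReadLogDescent.lean`) for `j = ι′⁻¹|_{K[p]}` and `ι_p = embAt K p 𝔭′`; closes nothing (BSD not
advanced).

## Statement (`eq_comp_embAt_of_forall_mem_iff_norm_lt_one`)
`K` a quadratic number field, `p = 𝔭𝔭′` with `𝔭 ≠ 𝔭′` both of degree one, `E` a normed field with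
an isometric `e : ℚ_p → E` (meant: `ℂ_p`, or `ℚ̄_p`), `φ : K → E` a ring map such that for `k ∈ 𝓞 K`:
`k ∈ 𝔭′ ↔ ‖φ k‖ < 1` (the clause `BranchInducesPrime` of the door's frames, read at the embedding).
Then `φ = e ∘ embAt K p 𝔭′`. Proof: `K/ℚ` is normal, so `φ = (e ∘ embAt_{𝔭′}) ∘ σ` for some
`σ ∈ Gal(K/ℚ)` (`Normal.algHomEquivAut`); if `σ ≠ 1` it is THE involution with
`embAt_𝔭 = embAt_{𝔭′} ∘ σ` (`exists_algEquiv_embAt_eq_comp`, `#Gal ≤ 2`), so `‖φ k‖ = ‖embAt_𝔭 k‖` and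
any `k ∈ 𝔭′ ∖ 𝔭` contradicts `X11b.mem_asIdeal_iff_norm_embAt_lt_one`.

References: Castella–Hsieh, Math. Ann. 370 (2018) §3.3 ("`𝔭` induced by `ι_p = ι⁻¹ ∘ ι_∞`");
Fröhlich–Taylor III §1 (1.14)(a) (embeddings and primes); Silverman *AEC* (none needed).
-/

noncomputable section

open scoped Classical

open NumberField IsDedekindDomain Field
  Summit.BirchSwinnertonDyer.Rank1Residual
  Summit.BirchSwinnertonDyer.Rank1Residual.X11b

set_option linter.dupNamespace false
set_option autoImplicit false

namespace Summit.BirchSwinnertonDyer.BirchSwinnertonDyer.Theorems.SchneiderFree.KYRead.LogDescent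

variable {K : Type} [Field K] [NumberField K] {p : ℕ} [Fact p.Prime]

/-- In a group of automorphisms of order `≤ 2`, two non-trivial elements coincide. [folklore] -/
theorem algEquiv_eq_of_ne_one_of_finrank_eq_two (h2 : Module.finrank ℚ K = 2) {σ τ : K ≃ₐ[ℚ] K}
    (hσ : σ ≠ 1) (hτ : τ ≠ 1) : σ = τ := by
  have hcard : Fintype.card (K ≃ₐ[ℚ] K) ≤ 2 := h2 ▸ AlgEquiv.card_le
  by_contra hne
  have h3 : 2 < Fintype.card (K ≃ₐ[ℚ] K) :=
    Fintype.two_lt_card_iff.mpr ⟨1, σ, τ, hσ.symm, hτ.symm, hne⟩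
  omega

/-- **An embedding of the quadratic field `K` into a `p`-adic normed field that induces the degree-one
prime `𝔭′` is THE embedding `embAt K p 𝔭′` (followed by the structure map).** Hypotheses: `[K:ℚ] = 2`;
`𝔭 ≠ 𝔭′` degree-one primes above `p`; `e : ℚ_p → E` isometric; `φ : K → E` with
`k ∈ 𝔭′ ↔ ‖φ k‖ < 1` on `𝓞 K`. [cite: CastellaHsieh2018, §3.3 (the prime 𝔭 induced by ι_p = ι⁻¹ ∘ ι_∞; arXiv:1505.08165 p. 9)]
[cite: FrohlichTaylor1990, Ch. III §1 (1.14)(a)] -/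
theorem eq_comp_embAt_of_forall_mem_iff_norm_lt_one (h2 : Module.finrank ℚ K = 2)
    {𝔭 𝔭' : HeightOneSpectrum (𝓞 K)} (h𝔭 : ((p : ℕ) : 𝓞 K) ∈ 𝔭.asIdeal)
    (he : 𝔭.asIdeal.ramificationIdx (𝓞 ℚ) = 1) (hf : 𝔭.asIdeal.inertiaDeg (𝓞 ℚ) = 1)
    (h𝔭' : ((p : ℕ) : 𝓞 K) ∈ 𝔭'.asIdeal)
    (he' : 𝔭'.asIdeal.ramificationIdx (𝓞 ℚ) = 1) (hf' : 𝔭'.asIdeal.inertiaDeg (𝓞 ℚ) = 1)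
    (hne : 𝔭 ≠ 𝔭') {E : Type} [NormedField E] [CharZero E] (e : ℚ_[p] →+* E)
    (hee : ∀ x, ‖e x‖ = ‖x‖) (φ : K →+* E)
    (hφ : ∀ k : 𝓞 K, k ∈ 𝔭'.asIdeal ↔ ‖φ (k : K)‖ < 1) (x : K) :
    φ x = e (embAt K p 𝔭' h𝔭' he' hf' x) := by
  letI : Algebra K E := (e.comp (embAt K p 𝔭' h𝔭' he' hf')).toAlgebra
  haveI : Algebra.IsQuadraticExtension ℚ K := { finrank_eq_two' := h2 }
  set ψ : K →ₐ[ℚ] E := φ.toRatAlgHom with hψ_def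
  set σ : K ≃ₐ[ℚ] K := Normal.algHomEquivAut ℚ E K ψ with hσ_def
  have hψ : ψ = (IsScalarTower.toAlgHom ℚ K E).comp σ.toAlgHom :=
    ((Normal.algHomEquivAut ℚ E K).symm_apply_apply ψ).symm
  have happ : ∀ y, φ y = e (embAt K p 𝔭' h𝔭' he' hf' (σ y)) := by
    intro y
    have hy := AlgHom.congr_fun hψ y
    rw [hψ_def, RingHom.toRatAlgHom_apply] at hy
    rw [hy]
    rfl
  by_cases hσ1 : σ = 1
  · rw [happ, hσ1, AlgEquiv.one_apply]
  · exfalso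
    -- `σ` is THE involution, along which `embAt_𝔭 = embAt_{𝔭'} ∘ σ`
    obtain ⟨σ₀, hσ₀1, -, hσ₀⟩ :=
      SchneiderFreeAdditiveX3.exists_algEquiv_embAt_eq_comp h2 h𝔭' he' hf' h𝔭 he hf hne
    have hσσ : σ = σ₀ := algEquiv_eq_of_ne_one_of_finrank_eq_two h2 hσ1 hσ₀1
    -- a witness `k ∈ 𝔭' ∖ 𝔭`
    have hnle : ¬ 𝔭'.asIdeal ≤ 𝔭.asIdeal := fun hle ↦ hne
      (HeightOneSpectrum.ext ((HeightOneSpectrum.isMaximal 𝔭').eq_of_le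
        (HeightOneSpectrum.isMaximal 𝔭).ne_top hle)).symm
    obtain ⟨k, hk', hk⟩ := SetLike.not_le_iff_exists.mp hnle
    have hlt : ‖φ (k : K)‖ < 1 := (hφ k).mp hk'
    rw [happ, hσσ, ← hσ₀, hee] at hlt
    exact hk ((mem_asIdeal_iff_norm_embAt_lt_one 𝔭 h𝔭 he hf k).mpr hlt)

/-- **Door form**: for an embedding datum `ι′ : ℚ̄_p ≃ ℂ` and `ι : K → ℂ` such that `ι′⁻¹ ∘ ι` induces
the degree-one prime `𝔭′` (`k ∈ 𝔭′ ↔ ‖ι′⁻¹(ι k)‖ < 1` on `𝓞 K` — the clause `BranchInducesPrime p ι′ 𝔭′`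
read at the embedding `ι`), `ι′⁻¹(ι x) = embAt K p 𝔭′ x` in `ℚ̄_p` for every `x ∈ K`; hence the
embedding `K[p] ⊂ ℂ →ι′⁻¹ ℚ̄_p ⊂ ℂ_p` restricts on `K` to `ℚ_p ⊂ ℂ_p ∘ embAt K p 𝔭′`, the hypothesis
`hj` of `padicLog_map_eq_mul_logOmega_of_descent`. [cite: CastellaHsieh2018, §3.3 (arXiv:1505.08165 p. 9)] -/
theorem symm_apply_eq_embAt_of_forall_mem_iff_norm_lt_one (h2 : Module.finrank ℚ K = 2)
    {𝔭 𝔭' : HeightOneSpectrum (𝓞 K)} (h𝔭 : ((p : ℕ) : 𝓞 K) ∈ 𝔭.asIdeal)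
    (he : 𝔭.asIdeal.ramificationIdx (𝓞 ℚ) = 1) (hf : 𝔭.asIdeal.inertiaDeg (𝓞 ℚ) = 1)
    (h𝔭' : ((p : ℕ) : 𝓞 K) ∈ 𝔭'.asIdeal)
    (he' : 𝔭'.asIdeal.ramificationIdx (𝓞 ℚ) = 1) (hf' : 𝔭'.asIdeal.inertiaDeg (𝓞 ℚ) = 1)
    (hne : 𝔭 ≠ 𝔭') (ι' : PadicAlgCl p ≃+* ℂ) (ι : K →+* ℂ)
    (hind : ∀ k : 𝓞 K, k ∈ 𝔭'.asIdeal ↔ ‖ι'.symm (ι (k : K))‖ < 1) (x : K) :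
    ι'.symm (ι x) = algebraMap ℚ_[p] (PadicAlgCl p) (embAt K p 𝔭' h𝔭' he' hf' x) :=
  eq_comp_embAt_of_forall_mem_iff_norm_lt_one h2 h𝔭 he hf h𝔭' he' hf' hne
    (algebraMap ℚ_[p] (PadicAlgCl p)) (fun y ↦ PadicAlgCl.norm_extends p y)
    (ι'.symm.toRingHom.comp ι) hind x

end Summit.BirchSwinnertonDyer.BirchSwinnertonDyer.Theorems.SchneiderFree.KYRead.LogDescent

end
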